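import Summits.ABC.ABC.Theorems.CuspFieldPencilGoldenFromNFPencil
import Summits.ABC.ABC.Theorems.YuMatveevShapeRatCloses
import Summits.ABC.ABC.Theorems.PlacewiseSzpiroSingleTowerSzpiroBakerSinglePlace
import Literature.Barriers.ABC.BakerMethodBoundsThreeRoutesProofs
import Literature.Barriers.ABC.BakerMethodBoundsStewartYuProofs
import Literature.Barriers.ABC.BakerMethodBoundsStewartTijdemanProofs
import HarnessLib

/-!
# STUB-IDEAS sketch · `stub_splitCuspTriple` · ideator k2 · GEN 5 — FAMILY 2 (RESHAPE):
# one ratio, both places — LINEARISED (`y = log(13H²)`), ABSTRACT ENDGAME, three landable files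

Crux `GoldenCuspShadow` (stmt-ABC-26026), route `CuspFieldPencil`, skeleton sha a4ca286a….
Elaboration-only sketch: every `sorry` is a PROPOSED HELPER LEMMA; the sorry-free declarations
certify that the helpers compose to the stub AND to the crux BY NAME, and that the only external
input is the KERNEL THEOREM
`Summit.ABC.ABC.Theorems.approximationBound_rat_holds : ∃ K ≥ 1, PastenApproximationBound K`.

THE LINE (unchanged mathematics, GEN 4 of this seat = the converged "ℚ-line" of all six seats):
the cusp-0 distance function `ξ₀ = −Q/w²` (`Q = u² − 11uw − w²`, `1 − ξ₀ = u(u − 11w)/w²`, identity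
`T₀ : w² + Q = u(u − 11w)`) is fed ONCE to `Pasten.approx_div`; its p-adic clause at the primes
`p ∣ u` gives `log|u| ≤ 3Θ₀Y·Σ_{p∣u} p`, its archimedean clause gives the regime-free transfer
`log H ≤ log|u| + log 12 + Θ₀Y`; the primes of `u − 11w` never enter; `Θ₀ = theta K |Q| w² 0 ≤ K·C·R^η`;
cusp swap `(u,w) ↦ (w,−u)`; `min` ⇒ stub and crux.

GEN-5 RESHAPES (prover-cost cuts, each replacing a GEN-4 lemma):
* LINEARISE (change of the bounded variable): bound `y := log(13·H²)` instead of `log H`.  Then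
  `h(ξ₀) ≤ 2y` and the pre-bound is literally `y ≤ M · log max(e, 2y)` — the input shape of the tree
  lemma `Literature.Barriers.ABC.le_of_le_mul_log_max`; GEN 4's piecewise numerics lemma `Y2`
  (`log max(e,h) ≤ 3 log max(e, 2 log H)`) DISAPPEARS.
* ABSTRACT ENDGAME (strengthen-to-simplify): the self-improvement + exponent bookkeeping is stated
  ONCE over an arbitrary index type (`endgame_abstract`, pure real analysis, no `u, w`, no radicals) —
  a file a second prover can land IN PARALLEL with the number-theory file; reusable verbatim by
  `stub_conjugateCuspTriple`, `TwoTorsionFieldEconomy`, `GaussianTwoDivision`.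
* TRANSFER BY ONE INEQUALITY: `|1 − ξ₀| ≤ 12|u|/|w|` when `|u| ≤ |w|` (no `log` of a triple product):
  GEN 4's `C2` + `C3` merge into `cusp0_transfer`.
* `numerics_prime` is now two tree lemmas (`log_max_exp_mul_le` + `div_log_mul_add_le`) — PROVED here.
-/

set_option linter.dupNamespace false

noncomputable section

open Finset Real Height
open Literature.NumberTheory.DiophantineGeometry
open Literature.NumberTheory.DiophantineGeometry.Dioph
open Literature.NumberTheory.DiophantineGeometry.Pasten
open Literature.Barriers.ABC
open Summit.ABC.ABC.Theorems

namespace Summit.ABC.ABC.Cruxes.GoldenCuspShadow.SplitK2G5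

/-! ## 0 · The stub (verbatim), the two one-cusp targets, the min-form -/

/-- The registered stub signature `stub_splitCuspTriple`, verbatim. -/
def StubSplit : Prop :=
  ∀ ε : ℝ, 0 < ε → ∃ κ : ℝ, ∀ u w : ℤ, IsCoprime u w → u * w * (u ^ 2 - 11 * u * w - w ^ 2) ≠ 0 → Real.log (max (|(u : ℝ)|) (|(w : ℝ)|)) ≤ κ * (((UniqueFactorizationMonoid.radical (u * w * (u ^ 2 - 11 * u * w - w ^ 2))).natAbs : ℕ) : ℝ) ^ (ε : ℝ) * (((((UniqueFactorizationMonoid.radical u).natAbs : ℕ) : ℝ) * (((UniqueFactorizationMonoid.radical w).natAbs : ℕ) : ℝ)) ^ (2 / 3 : ℝ) * (((UniqueFactorizationMonoid.radical (u ^ 2 - 11 * u * w - w ^ 2)).natAbs : ℕ) : ℝ) ^ (1 / 3 : ℝ))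

/-- ONE-CUSP TARGET at the cusp `t = 0`: `log max(|u|,|w|) ≤ κ_ε · rad(uwQ)^ε · rad u`. -/
def RouteU : Prop :=
  ∀ ε : ℝ, 0 < ε → ∃ κ : ℝ, ∀ u w : ℤ, IsCoprime u w → u * w * (u ^ 2 - 11 * u * w - w ^ 2) ≠ 0 →
    Real.log (max (|(u : ℝ)|) (|(w : ℝ)|)) ≤
      κ * (((UniqueFactorizationMonoid.radical (u * w * (u ^ 2 - 11 * u * w - w ^ 2))).natAbs : ℕ) : ℝ) ^ (ε : ℝ) *
        (((UniqueFactorizationMonoid.radical u).natAbs : ℕ) : ℝ)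

/-- ONE-CUSP TARGET at the cusp `t = ∞`: `log max(|u|,|w|) ≤ κ_ε · rad(uwQ)^ε · rad w`. -/
def RouteW : Prop :=
  ∀ ε : ℝ, 0 < ε → ∃ κ : ℝ, ∀ u w : ℤ, IsCoprime u w → u * w * (u ^ 2 - 11 * u * w - w ^ 2) ≠ 0 →
    Real.log (max (|(u : ℝ)|) (|(w : ℝ)|)) ≤
      κ * (((UniqueFactorizationMonoid.radical (u * w * (u ^ 2 - 11 * u * w - w ^ 2))).natAbs : ℕ) : ℝ) ^ (ε : ℝ) *
        (((UniqueFactorizationMonoid.radical w).natAbs : ℕ) : ℝ)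

/-- The min-form (same text as GEN 2–4 and as k1/k3's `MinRadBound`):
`log max(|u|,|w|) ≤ κ_ε · rad(uwQ)^ε · min(rad u, rad w)`. -/
def CuspMinRadBound : Prop :=
  ∀ ε : ℝ, 0 < ε → ∃ κ : ℝ, ∀ u w : ℤ, IsCoprime u w → u * w * (u ^ 2 - 11 * u * w - w ^ 2) ≠ 0 →
    Real.log (max (|(u : ℝ)|) (|(w : ℝ)|)) ≤
      κ * (((UniqueFactorizationMonoid.radical (u * w * (u ^ 2 - 11 * u * w - w ^ 2))).natAbs : ℕ) : ℝ) ^ (ε : ℝ) *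
        min ((((UniqueFactorizationMonoid.radical u).natAbs : ℕ) : ℝ))
            ((((UniqueFactorizationMonoid.radical w).natAbs : ℕ) : ℝ))

/-! ## 1 · FILE B (pure analysis, parallel prover): the ABSTRACT ENDGAME -/

/-- **ENDGAME (abstract self-improvement; M−, ~50 lines, NO number theory).**  For a family of
non-negative reals `y i` with `1 ≤ m i ≤ R i`: if for every `η > 0` there is `A` with
`y i ≤ A · (R i)^η · m i · log max(e, 2 y i)` for all `i`, then for every `ε > 0` there is `κ` with
`y i ≤ κ · (R i)^ε · m i` for all `i`.
Proof: `η := min ε 1 / 3`; WLOG `A ≥ 1`; `M := A R^η m ≥ 1`; `le_of_le_mul_log_max` ⇒ `y ≤ 2M log(4M)`;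
`Real.log_le_rpow_div` ⇒ `log(4M) ≤ (4M)^η/η`; `M^{1+η} ≤ A² R^{η(1+η)} m R^η` (`m^η ≤ R^η`);
`2η + η² ≤ 3η ≤ ε`, `R ≥ 1` (`Real.rpow_le_rpow_of_exponent_le`); `κ := 8A²/η`. -/
theorem endgame_abstract {ι : Type*} {y R m : ι → ℝ}
    (hy : ∀ i, 0 ≤ y i) (hR : ∀ i, 1 ≤ R i) (hm : ∀ i, 1 ≤ m i) (hmR : ∀ i, m i ≤ R i)
    (hpre : ∀ η : ℝ, 0 < η → ∃ A : ℝ, ∀ i,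
      y i ≤ A * R i ^ η * m i * Real.log (max (Real.exp 1) (2 * y i))) :
    ∀ ε : ℝ, 0 < ε → ∃ κ : ℝ, ∀ i, y i ≤ κ * R i ^ ε * m i := by
  sorry

/-! ## 2 · Objects (abbreviations only; no new notions) and ring identities (proved) -/

/-- `Q(u,w) = u² − 11uw − w²` (norm form of the two irrational cusps of `X₁(5)`). -/
abbrev Q (u w : ℤ) : ℤ := u ^ 2 - 11 * u * w - w ^ 2

/-- `H(u,w) = max(|u|,|w|)` as a real number. -/
abbrev H (u w : ℤ) : ℝ := max |(u : ℝ)| |(w : ℝ)|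

/-- THE LINEARISED VARIABLE `y = log(13·H²)` (`≥ log 13 > 0`, `≥ log H`, and `h(ξ₀) ≤ 2y`). -/
abbrev Ylin (u w : ℤ) : ℝ := Real.log (13 * H u w ^ 2)

/-- `sign z` as a rational number. -/
abbrev sgn (z : ℤ) : ℚ := ((Int.sign z : ℤ) : ℚ)

/-- THE ONE RATIO `ξ₀ = −Q/w²` in the `approx_div` shape `ζ · (x : ℚ)/y`, `x = |Q|`, `y = |w|²`, `ζ = −sign Q`. -/
abbrev xiU (u w : ℤ) : ℚ := (-sgn (Q u w)) * ((((Q u w).natAbs : ℕ) : ℚ) / ((w.natAbs ^ 2 : ℕ) : ℚ))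

/-- `Θ₀ = theta K |Q| |w|² 0` — Pasten's `Θ` of the one ratio (only the primes of `Q` and `w`). -/
abbrev Th (K : ℝ) (u w : ℤ) : ℝ := theta K (Q u w).natAbs (w.natAbs ^ 2) 0

/-- `Y = log max(e, h(ξ₀))` — the common log-log factor of BOTH clauses of the one call. -/
abbrev Yxi (u w : ℤ) : ℝ := Real.log (max (Real.exp 1) (logHeight₁ (xiU u w)))

/-- `R = rad(u·w·Q)` as a real number (the radical is computed in `ℤ`, then `natAbs`, then cast). -/
abbrev Rr (u w : ℤ) : ℝ := (((UniqueFactorizationMonoid.radical (u * w * Q u w)).natAbs : ℕ) : ℝ)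

/-- `rad z` as a real number. -/
abbrev radR (z : ℤ) : ℝ := (((UniqueFactorizationMonoid.radical z).natAbs : ℕ) : ℝ)

/-- `T₀ : w² + Q = u(u − 11w)`, i.e. `1 − ξ₀ = u(u−11w)/w²`. -/
theorem tU (u w : ℤ) : w ^ 2 + Q u w = u * (u - 11 * w) := by
  simp only [Q]; ring

/-- The cusp swap `(u, w) ↦ (w, −u)` negates `Q` … -/
theorem Q_swap (u w : ℤ) : Q w (-u) = -Q u w := by
  simp only [Q]; ring

/-- … and FIXES the product `u·w·Q` literally (so `rad(uwQ)` is unchanged). -/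
theorem prod_swap (u w : ℤ) : w * (-u) * Q w (-u) = u * w * Q u w := by
  simp only [Q]; ring

/-- H0 (cast bookkeeping, proved): `rad z`, as a real, is the product of the rational primes of `z`. -/
theorem natAbs_radical_cast (z : ℤ) : radR z = ∏ p ∈ z.natAbs.primeFactors, (p : ℝ) := by
  simp only [radR]
  rw [← Int.radical_natAbs_eq_radical, Int.natAbs_natCast, Nat.radical_eq_prod_primeFactors, Nat.cast_prod]

/-- H1 (proved): `1 ≤ rad z` as a real. -/
theorem one_le_radR (z : ℤ) : 1 ≤ radR z := by
  simp only [radR]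
  exact_mod_cast Int.natAbs_pos.mpr (UniqueFactorizationMonoid.radical_ne_zero (a := z))

/-! ## 3 · FILE A (number theory, ~200 lines): the ONE call and its two clauses -/

/-- A1 (XS, proved): `ζ = −sign Q = ±1` for `Q ≠ 0`. -/
theorem neg_sgn_cases {z : ℤ} (hz : z ≠ 0) : (-sgn z = 1 ∨ -sgn z = -1) := by
  rcases lt_or_gt_of_ne hz with h | h
  · left; simp [sgn, Int.sign_eq_neg_one_of_neg h]
  · right; simp [sgn, Int.sign_eq_one_of_pos h]

/-- A2 (XS–S): `1 − ξ₀ = u(u − 11w)/w²` (`Int.sign_mul_natAbs`, `Int.natCast_natAbs`/`sq_abs`, `tU`). -/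
theorem one_sub_xiU {u w : ℤ} (hw : w ≠ 0) :
    1 - xiU u w = ((u : ℚ) * (u - 11 * w)) / (w : ℚ) ^ 2 := by
  sorry

/-- E1 (XS): the cusp-0 escape `u = 11w` forces `(u, w) = ±(11, 1)` (`w` is a unit), so `H = 11`. -/
theorem escape_u {u w : ℤ} (h : IsCoprime u w) (he : u - 11 * w = 0) : H u w = 11 := by
  sorry

/-- E3 (S−): `x·y > 1`: `|Q|·w² = 1` would force `w = ±1`, `u(u ∓ 11) = w² + Q ∈ {0, 2}` — `0` is the escape,
`2` is insoluble (`u ∣ 2`, four cases). -/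
theorem one_lt_xy_u {u w : ℤ} (h0 : u * w * Q u w ≠ 0) (hne : u - 11 * w ≠ 0) :
    1 < (Q u w).natAbs * w.natAbs ^ 2 := by
  sorry

/-- E5 (XS, proved): `gcd(|Q|, |w|²) = 1` (`GoldenFromNFPencil.isCoprime_quadForm_right`). -/
theorem coprime_xy_u {u w : ℤ} (h : IsCoprime u w) : ((Q u w).natAbs).Coprime (w.natAbs ^ 2) := by
  have h1 : IsCoprime (Q u w) w := (GoldenFromNFPencil.isCoprime_quadForm_right h).symm
  exact (Int.isCoprime_iff_nat_coprime.mp h1).pow_right 2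

/-- E6 (XS): `ξ₀ ≠ 1` off the escape (by A2: `1 − ξ₀ = u(u−11w)/w² ≠ 0`). -/
theorem xiU_ne_one {u w : ℤ} (h0 : u * w * Q u w ≠ 0) (hne : u - 11 * w ≠ 0) : xiU u w ≠ 1 := by
  sorry

/-- C0 (PROVED — the ONE CALL with its side conditions A1/E3/E5/E6): both clauses of
`Pasten.approx_div` for `ξ₀`, with `Θ₀ = Th K u w`; the exact term File A uses twice. -/
theorem cusp0_call {K : ℝ} (hK : 1 ≤ K) (hP : PastenApproximationBound K) {u w : ℤ}
    (h : IsCoprime u w) (h0 : u * w * Q u w ≠ 0) (hne : u - 11 * w ≠ 0) :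
    (-Real.log |((1 - xiU u w : ℚ) : ℝ)| < Th K u w * Yxi u w) ∧
    ∀ p : ℕ, p.Prime → (padicValRat p (1 - xiU u w) : ℝ) * Real.log p <
        Th K u w * ((p / Real.log p) * Real.log (max (Real.exp 1) (p * logHeight₁ (xiU u w)))) := by
  obtain ⟨huw, hQ⟩ := mul_ne_zero_iff.mp h0
  obtain ⟨_, hw⟩ := mul_ne_zero_iff.mp huw
  have hx : (Q u w).natAbs ≠ 0 := Int.natAbs_ne_zero.mpr hQ
  have hy : w.natAbs ^ 2 ≠ 0 := pow_ne_zero _ (Int.natAbs_ne_zero.mpr hw)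
  exact approx_div hK hP hx hy (coprime_xy_u h) (one_lt_xy_u h0 hne) 0 (neg_sgn_cases hQ)
    (xiU_ne_one h0 hne)

/-- P1 (S): for `p ∣ u`: `ν_p(u) ≤ ν_p(u) + ν_p(u − 11w) = ord_p(1 − ξ₀)` (`p ∤ w` by coprimality; A2,
`padicValRat.div`, `padicValRat.of_int`, `padicValInt.mul`, `padicValInt` of `w² = 0`, `Nat.factorization_def`). -/
theorem factorization_le_padicValRat_xiU {u w : ℤ} (h : IsCoprime u w) (h0 : u * w * Q u w ≠ 0)
    (hne : u - 11 * w ≠ 0) {p : ℕ} (hp : p ∈ u.natAbs.primeFactors) :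
    ((u.natAbs.factorization p : ℕ) : ℝ) ≤ ((padicValRat p (1 - xiU u w) : ℤ) : ℝ) := by
  sorry

/-- P2 (S, generic = the divisor form of the summation inside `ThreeRoutes.log_lt_route_a`):
`log|u| = ∑_{p∣u} ν_p(u) log p` (`log_eq_sum_factorization_mul_log`) against a prime-by-prime bound. -/
theorem log_natAbs_le_of_padic {u : ℤ} (hu : u ≠ 0) {ξ : ℚ} {Θ : ℝ} {F : ℕ → ℝ}
    (hval : ∀ p ∈ u.natAbs.primeFactors, ((u.natAbs.factorization p : ℕ) : ℝ) ≤ ((padicValRat p (1 - ξ) : ℤ) : ℝ))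
    (hbd : ∀ p : ℕ, p.Prime → ((padicValRat p (1 - ξ) : ℤ) : ℝ) * Real.log p < Θ * F p) :
    Real.log |(u : ℝ)| ≤ Θ * ∑ p ∈ u.natAbs.primeFactors, F p := by
  sorry

/-- P3 (XS, PROVED from two tree lemmas): `(p/log p) · log max(e, p·h) ≤ 3p · log max(e, h)`. -/
theorem numerics_prime {p : ℕ} (hp : p.Prime) (h : ℝ) :
    (p : ℝ) / Real.log p * Real.log (max (Real.exp 1) (p * h)) ≤
      3 * p * Real.log (max (Real.exp 1) h) := by
  have hp1 : (1 : ℝ) ≤ p := by exact_mod_cast hp.one_lt.le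
  have hp2 : (2 : ℝ) ≤ p := by exact_mod_cast hp.two_le
  have hpl : 0 ≤ (p : ℝ) / Real.log p := div_nonneg (by linarith) (Real.log_nonneg hp1)
  calc (p : ℝ) / Real.log p * Real.log (max (Real.exp 1) (p * h))
      ≤ (p : ℝ) / Real.log p * (Real.log p + Real.log (max (Real.exp 1) h)) :=
        mul_le_mul_of_nonneg_left (log_max_exp_mul_le hp1) hpl
    _ ≤ 3 * p * Real.log (max (Real.exp 1) h) := div_log_mul_add_le hp2 (one_le_log_max_exp h)

/-- C1 (M−, p-adic clause summed over `p ∣ u`): `log|u| ≤ 3 · Θ₀ · Y · Σ_{p ∣ u} p`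
(C0.2 + P1 + P2 with `F p := 3 p Y` via P3, `theta_nonneg`).  The primes of `u − 11w` never enter. -/
theorem cusp0_padic {K : ℝ} (hK : 1 ≤ K) (hP : PastenApproximationBound K) {u w : ℤ}
    (h : IsCoprime u w) (h0 : u * w * Q u w ≠ 0) (hne : u - 11 * w ≠ 0) :
    Real.log |(u : ℝ)| ≤ 3 * Th K u w * Yxi u w * ∑ p ∈ u.natAbs.primeFactors, (p : ℝ) := by
  sorry

/-- C2 (S, the transfer inequality): `|1 − ξ₀| = |u|·|u − 11w| / w² ≤ 12|u|/|w|` when `|u| ≤ |w|`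
(A2 cast to `ℝ`; `|u − 11w| ≤ |u| + 11|w| ≤ 12|w|`). -/
theorem abs_one_sub_xiU_le {u w : ℤ} (h0 : u * w * Q u w ≠ 0) (hle : |(u : ℝ)| ≤ |(w : ℝ)|) :
    |((1 - xiU u w : ℚ) : ℝ)| ≤ 12 * |(u : ℝ)| / |(w : ℝ)| := by
  sorry

/-- C3 (S, REGIME-FREE transfer): `log H ≤ log|u| + log 12 + Θ₀ · Y`.
Case `|w| ≤ |u|`: `H = |u|` and `log 12 + Θ₀Y ≥ 0` (`theta_nonneg`, `Y ≥ 1`).  Case `|u| < |w|`: `H = |w|` and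
C0.1 + C2: `−log(12|u|/|w|) ≤ −log|1 − ξ₀| < Θ₀Y` (`Real.log_le_log`, `|1 − ξ₀| > 0` by E6), i.e.
`log|w| < log|u| + log 12 + Θ₀Y` (`Real.log_div`, `Real.log_mul`, `|u| ≥ 1`). -/
theorem cusp0_transfer {K : ℝ} (hK : 1 ≤ K) (hP : PastenApproximationBound K) {u w : ℤ}
    (h : IsCoprime u w) (h0 : u * w * Q u w ≠ 0) (hne : u - 11 * w ≠ 0) :
    Real.log (H u w) ≤ Real.log |(u : ℝ)| + Real.log 12 + Th K u w * Yxi u w := by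
  sorry

/-- C4 (PROVED, composition of C1 and C3): the one-cusp pre-bound before absorption. -/
theorem cusp0_pre {K : ℝ} (hK : 1 ≤ K) (hP : PastenApproximationBound K) {u w : ℤ}
    (h : IsCoprime u w) (h0 : u * w * Q u w ≠ 0) (hne : u - 11 * w ≠ 0) :
    Real.log (H u w) ≤
      Real.log 12 + Th K u w * Yxi u w * (1 + 3 * ∑ p ∈ u.natAbs.primeFactors, (p : ℝ)) := by
  have h1 := cusp0_padic hK hP h h0 hne
  have h2 := cusp0_transfer hK hP h h0 hne
  have h3 : Th K u w * Yxi u w * (1 + 3 * ∑ p ∈ u.natAbs.primeFactors, (p : ℝ)) =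
      Th K u w * Yxi u w + 3 * Th K u w * Yxi u w * ∑ p ∈ u.natAbs.primeFactors, (p : ℝ) := by ring
  linarith

/-! ## 4 · FILE C, part 1 (absorption, ~120 lines): `h(ξ₀) ≤ 2y`, `Θ₀ ≪ R^η`, `Σ p ≤ rad u` -/

/-- Y1 (S): `h(ξ₀) ≤ log|Q| + log w² ≤ log(13H²) + log(13H²) = 2y`
(`Pasten.logHeight₁_sign_mul_div_le`; `|Q| ≤ 13H²`, `w² ≤ H² ≤ 13H²`). -/
theorem logHeight₁_xiU_le {u w : ℤ} (h0 : u * w * Q u w ≠ 0) :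
    logHeight₁ (xiU u w) ≤ 2 * Ylin u w := by
  sorry

/-- Y1' (XS, proved): hence `Y = log max(e, h(ξ₀)) ≤ log max(e, 2y)`. -/
theorem Yxi_le {u w : ℤ} (h0 : u * w * Q u w ≠ 0) :
    Yxi u w ≤ Real.log (max (Real.exp 1) (2 * Ylin u w)) :=
  log_max_exp_mono (logHeight₁_xiU_le h0)

/-- T0 (S, radical bookkeeping): `rad(|Q|, |w|², |u|) = rad(u·w·Q)` as natural numbers
(`Nat.primeFactors_mul`, `Nat.primeFactors_pow`, `Int.natAbs_mul`, `Nat.radical_eq_prod_primeFactors`). -/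
theorem rad_aux_eq {u w : ℤ} (h0 : u * w * Q u w ≠ 0) :
    rad (Q u w).natAbs (w.natAbs ^ 2) u.natAbs = (UniqueFactorizationMonoid.radical (u * w * Q u w)).natAbs := by
  sorry

/-- T1 (XS after T0): `Θ₀ ≤ K · C · R^η` — ONE tree call
`SingleTowerSzpiroLine.theta_zero_le_mul_rpow hK hη hC hx hy (coprime_xy_u h) (dvd_mul_right _ _) h0'` with
`(u, v, a, b, c) := (|Q|, |w|², |Q|, |w|², |u|)`, then `rad_aux_eq`. -/
theorem theta_cusp0_le {K C η : ℝ} (hK : 1 ≤ K) (hη : 0 ≤ η)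
    (hC : ∀ S : Finset ℕ, (∀ p ∈ S, p.Prime) → ∏ p ∈ S, K * Real.log p / (p : ℝ) ^ η ≤ C)
    {u w : ℤ} (h : IsCoprime u w) (h0 : u * w * Q u w ≠ 0) :
    Th K u w ≤ K * C * Rr u w ^ η := by
  sorry

/-- J3 (XS): `1 + 3 Σ_{p ∣ u} p ≤ 4 · rad u` (`StewartTijdeman.sum_le_prod_of_two_le`, H0, H1). -/
theorem one_add_three_sum_le (u : ℤ) :
    1 + 3 * ∑ p ∈ u.natAbs.primeFactors, (p : ℝ) ≤ 4 * radR u := by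
  sorry

/-! ## 5 · FILE C, part 2 (~120 lines): the linearised pre-bound, the endgame call, the swap, `min` -/

/-- G1 (M−, the heart, ~50 lines): for every `η > 0` there is `A` with
`y ≤ A · R^η · rad u · log max(e, 2y)`, `y = log(13H²)`, for ALL coprime `(u, w)` with `uwQ ≠ 0`.
Proof: `⟨C, hC1, hC⟩ := SingleTowerSzpiroLine.exists_prod_mul_log_div_rpow_le (A := K) hK0 hη`,
`A := log 1872 + 8·K·C`.  Escape `u = 11w`: `H = 11` (E1), `y = log 1573 ≤ A` and every other factor is `≥ 1`.
Else C4: `log H ≤ log 12 + Θ₀·Yxi·(1+3Σ)`, so `y = log 13 + 2 log H ≤ log 1872 + 2Θ₀(1+3Σ)·Yxi ≤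
(log 1872 + 2Θ₀(1+3Σ)) · log max(e, 2y)` (Y1', `one_le_log_max_exp`), and `2Θ₀(1+3Σ) ≤ 2(KCR^η)(4 rad u)` (T1, J3). -/
theorem preRouteU {K : ℝ} (hK : 1 ≤ K) (hP : PastenApproximationBound K) {η : ℝ} (hη : 0 < η) :
    ∃ A : ℝ, ∀ u w : ℤ, IsCoprime u w → u * w * Q u w ≠ 0 →
      Ylin u w ≤ A * Rr u w ^ η * radR u * Real.log (max (Real.exp 1) (2 * Ylin u w)) := by
  sorry

/-- The admissible pairs, as an index type for `endgame_abstract`. -/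
abbrev Adm : Type := {q : ℤ × ℤ // IsCoprime q.1 q.2 ∧ q.1 * q.2 * Q q.1 q.2 ≠ 0}

/-- G2 (S, bookkeeping for the endgame call): on admissible pairs `0 ≤ y`, `1 ≤ rad u ≤ R`, `1 ≤ R`
(H1; `R = rad u · rad w · rad Q` by `GoldenFromNFPencil.natAbs_radical_prod`, each factor `≥ 1`). -/
theorem adm_bounds (i : Adm) :
    0 ≤ Ylin i.1.1 i.1.2 ∧ 1 ≤ Rr i.1.1 i.1.2 ∧ 1 ≤ radR i.1.1 ∧ radR i.1.1 ≤ Rr i.1.1 i.1.2 := by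
  sorry

/-- G3 (S, PROVED modulo G1/G2/endgame): `RouteU` — unpack the endgame over `Adm` and use `log H ≤ y`. -/
theorem routeU_of_pasten {K : ℝ} (hK : 1 ≤ K) (hP : PastenApproximationBound K) : RouteU := by
  have hE := endgame_abstract (ι := Adm) (y := fun i => Ylin i.1.1 i.1.2) (R := fun i => Rr i.1.1 i.1.2)
    (m := fun i => radR i.1.1) (fun i => (adm_bounds i).1) (fun i => (adm_bounds i).2.1)
    (fun i => (adm_bounds i).2.2.1) (fun i => (adm_bounds i).2.2.2)
    (fun η hη => by
      obtain ⟨A, hA⟩ := preRouteU hK hP hη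
      exact ⟨A, fun i => hA i.1.1 i.1.2 i.2.1 i.2.2⟩)
  intro ε hε
  obtain ⟨κ, hκ⟩ := hE ε hε
  refine ⟨κ, fun u w h h0 => ?_⟩
  have key := hκ ⟨(u, w), h, h0⟩
  -- `log H ≤ log(13 H²)` since `H ≥ 1`
  have hH1 : 1 ≤ H u w := by
    obtain ⟨huw, _⟩ := mul_ne_zero_iff.mp h0
    obtain ⟨hu, _⟩ := mul_ne_zero_iff.mp huw
    have : (1 : ℝ) ≤ |(u : ℝ)| := by exact_mod_cast Int.one_le_abs hu
    exact this.trans (le_max_left _ _)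
  have hlog : Real.log (H u w) ≤ Ylin u w := by
    apply Real.log_le_log (by linarith)
    nlinarith
  exact hlog.trans key

/-- G4 (XS–S, the cusp swap `t ↦ −1/t`): `RouteU → RouteW` by applying `RouteU` to `(w, −u)`:
`IsCoprime.neg_right`, `prod_swap` (same product, same radical), `abs_neg` + `max_comm` (same `H`),
radical of `−u` = radical of `u` up to `natAbs` (`Int.radical_natAbs_eq_radical`, `Int.natAbs_neg`). -/
theorem routeW_of_routeU : RouteU → RouteW := by
  sorry

/-- R0 (XS): the two one-cusp bounds give the min-form with `κ = max (max κ_U κ_W) 0`. -/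
theorem cuspMinRadBound_of_routes : RouteU → RouteW → CuspMinRadBound := by
  sorry

/-- R1 (S, real arithmetic): min-form ⇒ STUB.  Radicals are `≥ 1` (H1);
`min x y ≤ (x*y)^{1/2} ≤ (x*y)^{2/3}` for `x*y ≥ 1` (`Real.rpow_le_rpow_of_exponent_le`); `1 ≤ z^{1/3}`
(`Real.one_le_rpow`); `κ ↦ max κ 0`. -/
theorem stubSplit_of_cuspMinRadBound : CuspMinRadBound → StubSplit := by
  sorry

/-- R2 (S): min-form ⇒ CRUX: `min(rad u, rad w) ≤ (rad u · rad w)^{1/2} ≤ R^{1/2}` by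
`GoldenFromNFPencil.natAbs_radical_prod` (`R = rad u · rad w · rad Q`, each `≥ 1`); `R^ε · R^{1/2} = R^{1/2+ε}`
(`Real.rpow_add`); `κ ↦ max κ 0`. -/
theorem goldenCuspShadow_of_cuspMinRadBound :
    CuspMinRadBound → Summit.ABC.ABC.Theses.CuspFieldPencil.GoldenCuspShadow := by
  sorry

/-! ## 6 · Assembly (sorry-free): helpers ⇒ RouteU ⇒ RouteW ⇒ min-form ⇒ stub and crux, UNCONDITIONALLY -/

/-- `RouteU` holds outright: the input `∃ K ≥ 1, PastenApproximationBound K` is the kernel theorem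
`approximationBound_rat_holds` (route YuMatveevShapeRat, closed·proved). -/
theorem routeU_holds : RouteU := by
  obtain ⟨K, hK, hP⟩ := approximationBound_rat_holds
  exact routeU_of_pasten hK hP

/-- `RouteW` by the cusp swap. -/
theorem routeW_holds : RouteW :=
  routeW_of_routeU routeU_holds

/-- The min-form. -/
theorem cuspMinRadBound_holds : CuspMinRadBound :=
  cuspMinRadBound_of_routes routeU_holds routeW_holds

/-- THE STUB, modulo the sorried helpers only.  Land it with the VERBATIM registered header
`theorem stub_splitCuspTriple : <payload signature> := stubSplit_holds` (`--supports stmt-ABC-26026`). -/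
theorem stubSplit_holds : StubSplit :=
  stubSplit_of_cuspMinRadBound cuspMinRadBound_holds

/-- THE CRUX `GoldenCuspShadow` BY NAME, modulo the sorried helpers only (audit: proof-of-item). -/
theorem goldenCuspShadow_holds : Summit.ABC.ABC.Theses.CuspFieldPencil.GoldenCuspShadow :=
  goldenCuspShadow_of_cuspMinRadBound cuspMinRadBound_holds

/-! ## 7 · Unit tests of the side conditions at the extremal / degenerate pairs (kernel-checked) -/

/-- The escape pair `(11, 1)`: `u − 11w = 0`, `Q = −1`, `|Q|·w² = 1` (so `approx_div` is NOT called there);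
`y = log(13·121) = log 1573 < log 1872 ≤ A`. -/
example : Q 11 1 = -1 ∧ (11 : ℤ) - 11 * 1 = 0 ∧ (13 : ℤ) * 11 ^ 2 = 1573 ∧ (1573 : ℤ) < 13 * 12 ^ 2 := by decide

/-- Off the escape `x·y = |Q|·w² > 1` already at the smallest pairs. -/
example : Q 1 1 = -11 ∧ Q 1 (-1) = 11 ∧ Q 2 1 = -19 ∧ Q 12 1 = 11 ∧ Q 11 (-1) = 241 := by decide

/-- The swap is `t ↦ −1/t` on the level of `Q`, and `(1, −11)` is the cusp-∞ escape. -/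
example : Q 1 (-11) = -Q 11 1 ∧ (1 : ℤ) - 11 * (-11) ≠ 0 ∧ (-11 : ℤ) - 11 * (-1) = 0 := by decide

/-- `|Q| ≤ 13 H²` is sharp in direction only: `Q(1,−1) = 11`, `Q(2,−1)·… = ` at `(1,-1)` `H = 1`, `13H² = 13 ≥ 11`. -/
example : (Q 1 (-1)).natAbs ≤ 13 * 1 ^ 2 ∧ (Q 3 (-2)).natAbs ≤ 13 * 3 ^ 2 := by decide

end Summit.ABC.ABC.Cruxes.GoldenCuspShadow.SplitK2G5

end
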